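import Summits.HodgeConjecture.HodgeConjecture.Theorems.R90S5OneDimNotThetaOfRecord        -- ★ R90-C14-p02 (DEAL #17b′): `not_isThetaOfRecord_of_oneDim` (law (T′) GLOBAL ASSEMBLY); brings ★ `IsThetaOfRecord`
import Summits.HodgeConjecture.HodgeConjecture.Theorems.R90S5SpectralPacketHOfOneDim       -- ★ K2E1-p12 (DEAL #20): `piTwoOfOneDim ξ v = ⟦ℂ_{ξ_v ∘ inl}⟧` (the `U(Φ₂)`-block of record of a one-dimensional `ξ`)
import HarnessLib

/-!
# R90-TF · S5 «Ch. 13.3» — LAW (T′) AT THE ONE-DIMENSIONAL `ξ` OF RECORD: the `U(Φ₂)`-block `v ↦ ⟦(η_v ψ_v) ∘ det₀⟧` of a one-dimensional automorphic `ξ` of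
# `H = U(2) × U(1)` is NEVER «of the form `ρ(θ)`, θ regular» (`¬ R90.S5.IsThetaOfRecord μω (R90.S5.piTwoOfOneDim ξ)`)
# (`Theorems/R90S5OneDimNotThetaOfRecordXi.lean`; seat R90-C133-p03 (g0) — the (T′) PAY head, R90-C133-plan (g0) 2026-09-04T16:29:08Z ∕ 16:37:52Z)

Cell `hodgecm-mathlib`, crux H413 (`stmt-HodgeConjecture-24833`), route of record `HCCMUnconditional`; programme R90-TF (brief `director/R90-BRIEF.v2.md`), section S5 (base `R90-C133`).
PROOF lane (`--supports stmt-HodgeConjecture-24833 --as helper`): theorems only (no `def`, no instance, no notation, no `sorry`); Lines-free.  The junction: S5 file C's law (T′)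
`stub_R90_S5_oneDim_notTheta` («`IsOneDimH ρ → ¬ IsThetaOfRecord (ρ's U(2)-block)`», reserved in C ED. 4 :47 ∕ :409; its `IsOneDimH` and the U(2)-block of record are ★ DEAL #20's
`IsOneDimH` ∕ `piTwoOfOneDim`) reads the head below BY NAME.

THE PRINT [Rogawski1990 §11.1 Prop. 11.1.1 (a) p. 162: a discrete L-packet of `U(2)` «has more than one element if and only if it is of the form `ρ(θ)` for some θ regular» — a
one-dimensional `η ∘ det` is a singleton packet, hence not `ρ(θ)`; §11.4 Prop. 11.4.1 (a) vs (b) p. 166: `ψ_G(ρ(θ)) = i_{G̃}(θ̃₁μ⁻¹, θ̃₃μ⁻¹)` (unitary principal series at every split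
place) vs `ψ_G(η ∘ det) = η̃ ∘ det` (one-dimensional)].  IN THE TREE: ★ `not_isThetaOfRecord_of_oneDim` (R90-C14-p02; RULING (T′-GLOBAL): a cofinite string meets the infinitely many
split places, and at a split place a ONE-DIMENSIONAL class is not a constituent of the irreducible infinite-dimensional `i_{GL₂(L_w)}(ν₁, ν₃)`, `νᵢ` unitary — ★ R90-C14-p03
`not_isConstituentOf_parabolicIndGL_two_comap_of_finrank_eq_one`, ★ Zelevinsky irreducibility, obligations ★ `R90S5ThetaMemberLocalData`) applied to the family of record ★
`piTwoOfOneDim ξ v := ⟦SmoothIrrep.ofChar (ξ_v ∘ inl) _⟧`, one-dimensional at EVERY place (`Module.finrank_self ℂ`).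

CONTENTS (sorry-free):
* `not_isThetaOfRecord_piTwoOfOneDim` — (T′) at the ξ of record: `¬ IsThetaOfRecord L μω (piTwoOfOneDim ξ)` for every one-dimensional automorphic `ξ` and unitary `μω`.
* `not_isThetaOfRecord_of_eventually_eq_piTwoOfOneDim` — the same for ANY family agreeing with `piTwoOfOneDim ξ` at all but finitely many places (e.g. a family of local constituents of the
  automorphic character `ξ|_{U(Φ₂)}`, S10's `d j` reading), by ★ `IsThetaOfRecord.congr`.
* (ED. 2) `not_isThetaOfRecordDiscrete_of_constituents_eq_piTwoOfOneDim` — the DISCRETE reading (★ `IsThetaOfRecordDiscrete`): a discrete automorphic `ρ₁` of `U(Φ₂)` whose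
  `v`-constituents are, at all but finitely many `v`, the class `piTwoOfOneDim ξ v` (the automorphic character line `ξ|_{U(Φ₂)}` — ★ DEAL #20 `cmOccursInDiscreteSpectrum_piTwoOfOneDim` — or
  any `ρ₁` with those local constituents) is not `ρ(θ)`, θ regular.
* (ED. 3) HYPOTHESIS-FREE AT THE CHARACTER LINE OF RECORD: `not_isThetaOfRecordDiscrete_of_realises₂` (any `P₂` with ★ `Realises₂ P₂ ξ`) and
  **`not_isThetaOfRecordDiscrete_ofChar_xi`** — the discrete automorphic line `ℂ · ((η ψ) ∘ det)⁻¹` of `L²(U(Φ₂))` (★ `DiscreteAutomorphicRep.ofChar (cmDetChar L 2 Φ₂ (η ψ) …)⁻¹ μ₂`,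
  ★ `realises₂_ofChar`) is NOT `ρ(θ)`, θ regular — for every one-dimensional `ξ`, every automorphic `μ₂`, every unitary `μω`.
HONEST LABEL: helper; closes no socket by itself (C's (T′) stub is typ1's pay line); REL ≠ ★ ≠ BUILT; HC_CM is proved only modulo the 7 printed citations (2 remaining named inputs:
hLiu418 = stmt-HodgeConjecture-24832, h413 = stmt-HodgeConjecture-24833) until rung 0 closes.

[cite: Rogawski1990, §11.1 Prop. 11.1.1 (a) p. 162; §11.4 Prop. 11.4.1 (a)(b) p. 166; §13.3 p. 202; §12.1 p. 171] [cite: Zelevinsky1980, Thm. 4.2]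
-/

set_option autoImplicit false
-- the mandated namespace repeats the single-problem summit's segment (`HodgeConjecture.HodgeConjecture`)
set_option linter.dupNamespace false

noncomputable section

open NumberField IsDedekindDomain Filter
open Literature.NumberTheory.Rogawski1990 Literature.NumberTheory.GaloisRepresentations
open Literature.NumberTheory.Automorphic Literature.NumberTheory.Automorphic.UnitaryGroup

namespace Summit.HodgeConjecture.HodgeConjecture.R90.S5

variable (L : Type) [Field L] [NumberField L] [IsCMField L]

/-- **LAW (T′) AT THE ONE-DIMENSIONAL `ξ` OF RECORD**: for every one-dimensional automorphic `ξ` of `H` (★ `OneDimAutRepH`) and every unitary auxiliary `μω`, the `U(Φ₂)`-block of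
record `piTwoOfOneDim ξ = (v ↦ ⟦(η_v ψ_v) ∘ det₀⟧)` is NOT of the form `ρ(θ)`, θ regular (★ `IsThetaOfRecord`).  ★ `not_isThetaOfRecord_of_oneDim` at the witnesses
`r_v := SmoothIrrep.ofChar (ξ_v ∘ inl) _` (`finrank = 1`, `piTwoOfOneDim ξ v = ⟦r_v⟧` by `rfl`). [cite: Rogawski1990, §11.1 Prop. 11.1.1 (a) p. 162; §11.4 Prop. 11.4.1 (a)(b) p. 166] -/
theorem not_isThetaOfRecord_piTwoOfOneDim (μω : HeckeCharacter L) (hμu : μω.IsUnitary) (ξ : OneDimAutRepH L) :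
    ¬ IsThetaOfRecord L μω (piTwoOfOneDim ξ) :=
  not_isThetaOfRecord_of_oneDim L μω hμu (piTwoOfOneDim ξ) fun _ _ => ⟨_, Module.finrank_self ℂ, rfl⟩

/-- **(T′) FOR ANY FAMILY AGREEING A.E. WITH THE `U(Φ₂)`-BLOCK OF RECORD** (e.g. a family of `v`-constituents of the automorphic character `ξ|_{U(Φ₂)}` — S10's `d j` ∕ `IsThetaOfRecordDiscrete`
reading): `π₂ v = piTwoOfOneDim ξ v` for all but finitely many `v` ⇒ `¬ IsThetaOfRecord L μω π₂` (★ `IsThetaOfRecord.congr`: the predicate reads only the cofinite germ).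
[cite: Rogawski1990, §11.1 Prop. 11.1.1 (a) p. 162; §13.6 p. 209] -/
theorem not_isThetaOfRecord_of_eventually_eq_piTwoOfOneDim (μω : HeckeCharacter L) (hμu : μω.IsUnitary) (ξ : OneDimAutRepH L)
    (π₂ : ∀ v : HeightOneSpectrum (𝓞 ↥(maximalRealSubfield L)),
      IrrClass ((UnitaryGroup.cmDatum L 2 (Matrix.of fun i j : Fin 2 => if i.val + j.val + 1 = 2 then (1 : L) else 0)).Local v))
    (hπ₂ : ∀ᶠ v : HeightOneSpectrum (𝓞 ↥(maximalRealSubfield L)) in cofinite, π₂ v = piTwoOfOneDim ξ v) :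
    ¬ IsThetaOfRecord L μω π₂ := fun h =>
  not_isThetaOfRecord_piTwoOfOneDim L μω hμu ξ
    (h.congr L μω (π₂' := piTwoOfOneDim ξ) (hπ₂.mono fun _ hv => hv.symm))

/-! ## §2 (ED. 2) The DISCRETE reading: a discrete `ρ₁` of `U(Φ₂)` with the constituents of a character is not `ρ(θ)` -/

/-- **(T′), DISCRETE READING** (the shape S10's H-family `d : J → DiscreteClass (cmDatum L 2 Φ₂) μH` and C's `nHOfRecord` consume): if at all but finitely many finite places `v` every
`v`-constituent of the discrete automorphic `ρ₁` of `U(Φ₂)` (★ D6 currency: `IrrClass.comap (localPiEquiv v) c` a constituent of the smooth part of `ρ₁|_{U(Φ₂)(𝔸_f)}` along ★ `inclPlace v`)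
IS the one-dimensional class of record `piTwoOfOneDim ξ v` — as for the automorphic character line `ξ|_{U(Φ₂)}` — then `¬ IsThetaOfRecordDiscrete L μω ρ₁`: any witnessing family of
constituents agrees a.e. with `piTwoOfOneDim ξ`, and §1 applies. [cite: Rogawski1990, §11.1 Prop. 11.1.1 (a) p. 162; §11.5 p. 166; §13.6 p. 209] -/
theorem not_isThetaOfRecordDiscrete_of_constituents_eq_piTwoOfOneDim (μω : HeckeCharacter L) (hμu : μω.IsUnitary) (ξ : OneDimAutRepH L)
    {μH : MeasureTheory.Measure (adelicGroupData (↥(maximalRealSubfield L)) L (IsCMField.complexConj L) 2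
      (Matrix.of fun i j : Fin 2 => if i.val + j.val + 1 = 2 then (1 : L) else 0)).automorphicQuotient}
    [(adelicGroupData (↥(maximalRealSubfield L)) L (IsCMField.complexConj L) 2
      (Matrix.of fun i j : Fin 2 => if i.val + j.val + 1 = 2 then (1 : L) else 0)).IsAutomorphicMeasure μH]
    (ρ₁ : DiscreteAutomorphicRep (adelicGroupData (↥(maximalRealSubfield L)) L (IsCMField.complexConj L) 2
      (Matrix.of fun i j : Fin 2 => if i.val + j.val + 1 = 2 then (1 : L) else 0)) μH)
    (hρ₁ : ∀ᶠ v : HeightOneSpectrum (𝓞 ↥(maximalRealSubfield L)) in cofinite,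
      ∀ c : IrrClass ((UnitaryGroup.cmDatum L 2 (Matrix.of fun i j : Fin 2 => if i.val + j.val + 1 = 2 then (1 : L) else 0)).Local v),
        (IrrClass.comap (localPiEquiv L (IsCMField.complexConj L) 2 (Matrix.of fun i j : Fin 2 => if i.val + j.val + 1 = 2 then (1 : L) else 0) v) c).IsConstituentOf
            (ρ₁.finRep.smoothPart.toRepresentation.comp
              (inclPlace (↥(maximalRealSubfield L)) L (IsCMField.complexConj L) 2 (Matrix.of fun i j : Fin 2 => if i.val + j.val + 1 = 2 then (1 : L) else 0) v)) →
          c = piTwoOfOneDim ξ v) :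
    ¬ IsThetaOfRecordDiscrete L μω ρ₁ := by
  rintro ⟨π₂, hπ₂, hθ⟩
  exact not_isThetaOfRecord_of_eventually_eq_piTwoOfOneDim L μω hμu ξ π₂
    ((hρ₁.and hπ₂).mono fun v hv => hv.1 (π₂ v) hv.2) hθ

/-! ## §3 (ED. 3) HYPOTHESIS-FREE at the character line of record `ℂ · ((η ψ) ∘ det)⁻¹ ⊂ L²(U(Φ₂))` -/

open Summit.HodgeConjecture.HodgeConjecture.Cruxes.H413.F0P3cPKtupleHSideLetters (Realises₂)
open Summit.HodgeConjecture.HodgeConjecture.Cruxes.H413.F0P3cPKtupleU1Line (realises₂_ofChar isAutomorphic_eta_mul_psi)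

/-- **(T′), DISCRETE READING, FOR ANY `P₂` REALISING `ξ`** (★ `Realises₂ P₂ ξ`: the `v`-constituents of `P₂` are EXACTLY `⟦ℂ_{ξ_v ∘ inl}⟧ = piTwoOfOneDim ξ v` at every `v`):
`¬ IsThetaOfRecordDiscrete L μω P₂`. [cite: Rogawski1990, §11.1 Prop. 11.1.1 (a) p. 162; §13.3 pp. 202–203] -/
theorem not_isThetaOfRecordDiscrete_of_realises₂ (μω : HeckeCharacter L) (hμu : μω.IsUnitary) (ξ : OneDimAutRepH L)
    {μH : MeasureTheory.Measure (adelicGroupData (↥(maximalRealSubfield L)) L (IsCMField.complexConj L) 2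
      (Matrix.of fun i j : Fin 2 => if i.val + j.val + 1 = 2 then (1 : L) else 0)).automorphicQuotient}
    [(adelicGroupData (↥(maximalRealSubfield L)) L (IsCMField.complexConj L) 2
      (Matrix.of fun i j : Fin 2 => if i.val + j.val + 1 = 2 then (1 : L) else 0)).IsAutomorphicMeasure μH]
    (P₂ : DiscreteAutomorphicRep (adelicGroupData (↥(maximalRealSubfield L)) L (IsCMField.complexConj L) 2
      (Matrix.of fun i j : Fin 2 => if i.val + j.val + 1 = 2 then (1 : L) else 0)) μH)
    (h : Realises₂ P₂ ξ) : ¬ IsThetaOfRecordDiscrete L μω P₂ :=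
  not_isThetaOfRecordDiscrete_of_constituents_eq_piTwoOfOneDim L μω hμu ξ P₂ (Eventually.of_forall fun v c hc => (h v c).1 hc)

/-- **(T′) AT THE CHARACTER LINE OF RECORD — HYPOTHESIS-FREE**: for every one-dimensional automorphic `ξ = (η ψ) ∘ det₀ ⊠ ψ` of `H`, every automorphic measure `μ₂` on
`U(Φ₂)(L⁺)\U(Φ₂)(𝔸_{L⁺})` and every unitary `μω`, the discrete automorphic representation `ℂ · ((η ψ) ∘ det)⁻¹` of `U(Φ₂)` (★ `DiscreteAutomorphicRep.ofChar`, the `U(2)`-block of record of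
`ξ`; ★ `realises₂_ofChar`) is NOT of the form `ρ(θ)`, θ regular (★ `IsThetaOfRecordDiscrete`).  The (T′) law at the discrete level, as S10's `d j` ∕ C's `nHOfRecord` read it.
[cite: Rogawski1990, §11.1 Prop. 11.1.1 (a) p. 162; §11.4 Prop. 11.4.1 (a)(b) p. 166; §13.3 pp. 202–203] [cite: Gelbart1975, §2.A] -/
theorem not_isThetaOfRecordDiscrete_ofChar_xi (μω : HeckeCharacter L) (hμu : μω.IsUnitary) (ξ : OneDimAutRepH L)
    (μ₂ : MeasureTheory.Measure (adelicGroupData (↥(maximalRealSubfield L)) L (IsCMField.complexConj L) 2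
      (Matrix.of fun i j : Fin 2 => if i.val + j.val + 1 = 2 then (1 : L) else 0)).automorphicQuotient)
    [(adelicGroupData (↥(maximalRealSubfield L)) L (IsCMField.complexConj L) 2
      (Matrix.of fun i j : Fin 2 => if i.val + j.val + 1 = 2 then (1 : L) else 0)).IsAutomorphicMeasure μ₂] :
    ¬ IsThetaOfRecordDiscrete L μω
      (DiscreteAutomorphicRep.ofChar (cmDetChar L 2 (Matrix.of fun i j : Fin 2 => if i.val + j.val + 1 = 2 then (1 : L) else 0) (ξ.η * ξ.ψ)
        (isAutomorphic_eta_mul_psi ξ) (isUnit_antidiagOne_det L 2).ne_zero)⁻¹ μ₂) :=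
  not_isThetaOfRecordDiscrete_of_realises₂ L μω hμu ξ _ (realises₂_ofChar ξ)

end Summit.HodgeConjecture.HodgeConjecture.R90.S5

end
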